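import Mathlib.Analysis.SpecialFunctions.Pow.Real
import Mathlib.Algebra.Order.AbsoluteValue.Basic
import Mathlib.Algebra.Order.Ring.IsNonarchimedean
import HarnessLib

/-!
# [ExpEst] §1 "Heights" (Def. 1.4 – Lemma 1.6): the local quantities `J, J_{0∞}, J_{1∞}, J_{01}` of an
# absolute value and their comparison (Lemmas 1.5, 1.6) — PROVED

S. Mochizuki, I. Fesenko, Y. Hoshi, A. Minamide, W. Porowski, *Explicit estimates in inter-universal
Teichmüller theory*, Kodai Math. J. **45** (2022) 175–236 — [ExpEst], bib key `MochizukiEtAl2022`. §1, p.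
186–189 (pdf p12.l44 – p15 of the cell render `run/shared/lean/pub/abc-iut/plan/repair/lit/renders/MFHMP-
ExplicitEstimates-Kodai2022-book-anonnd-eeiutp`; journal page = pdf page + 174). CLASSICAL ("[elementary and
essentially well-known]", Introduction p. 180), independent of inter-universal Teichmüller theory: nothing is
claim-tagged, every numbered statement is a `theorem` with a proof. TAKES NO SIDE on [IUTchIII] Cor. 3.12; no abc
claim. Cell abc-iut, seat lit-abc-explicitiut (gen 3). Companion of `ExplicitEstimatesHeights.lean` (Def. 1.1 –
Lemma 1.3); used by Prop. 1.8 (the comparison `h^{𝔖-tor}(E)` vs `h(j(E))`, place by place).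

## Rendering

* Def. 1.4 is stated in print for any map `|·| : F → ℝ_{≥0}` with (i) multiplicative on `F^×`, (ii) `|0| = 0`,
  (iii) `|x + 1| ≤ |x| + 1`; it is only ever applied to absolute values `‖·‖_v` (proof of Prop. 1.8: "it is
  well-known that `‖·‖_v` satisfies the conditions (i), (ii), and (iii)"), and we type it for a Mathlib
  `AbsoluteValue K ℝ` on any field `K` (declared: marginally NARROWER carrier class, same content at every
  use); "nonarchimedean" in Lemma 1.6 (iv) ("`|x + 1| ≤ max{|x|, 1}`") is Mathlib's `IsNonarchimedean f`
  (`f (a + b) ≤ max (f a) (f b)`, equivalent for multiplicative `f`).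
* Lemma 1.6 (i) (the combinatorics `B = B'` of the six functions `A = {z, z⁻¹, 1−z, (1−z)⁻¹, z(z−1)⁻¹,
  (z−1)z⁻¹} = 𝔖₃·z`) is not typed as a statement about sets of functions; its use — the covering `F \ {0,1} =
  ⋃_σ σ·𝔻` of Lemma 1.6 (ii) and the `𝔖₃`-invariance of `J` and of `J_{0∞}J_{1∞}J_{01}` under the generators
  `z ↦ 1 − z`, `z ↦ z⁻¹` — is PROVED (`exists_moebius_mem_D`, `J_one_sub`, `J_inv`, `jProd_one_sub`, `jProd_inv`),
  exactly as the printed proof of (iii)/(iv) uses it ("we may assume without loss of generality that `α ∈ 𝔻`",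
  p. 188). Lemma 1.6 (iii) is typed for `ε ≥ 0` (print: `ε > 0`; the proof takes `ε = 0`).
-/

noncomputable section

namespace Literature.IUT.LogVolume

namespace ExpEst

/-! ## 4. Definition 1.4: the quantities `J, J_{0∞}, J_{1∞}, J_{01}` of an absolute value (p. 186) -/

section AbsValue

variable {K : Type*} [Field K] (f : AbsoluteValue K ℝ)

/-- **[ExpEst] Def. 1.4**: "`J(α) := |α² − α + 1|³·|α|^{-2}·|α − 1|^{-2}`" for `α ∈ F \ {0,1}` and `|·|` a map as
in Def. 1.4 (i)–(iii) — typed for a Mathlib absolute value `f`. [cite: MochizukiEtAl2022, Def 1.4 p. 186] -/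
def J (α : K) : ℝ := f (α ^ 2 - α + 1) ^ 3 / (f α ^ 2 * f (α - 1) ^ 2)

/-- **[ExpEst] Def. 1.4**: "`J_{0∞}(α) := max{|α|, |α|^{-1}}`". [cite: MochizukiEtAl2022, Def 1.4 p. 186] -/
def J0inf (α : K) : ℝ := max (f α) (f α)⁻¹

/-- **[ExpEst] Def. 1.4**: "`J_{1∞}(α) := max{|α − 1|, |α − 1|^{-1}}`". [cite: MochizukiEtAl2022, Def 1.4 p. 186] -/
def J1inf (α : K) : ℝ := max (f (α - 1)) (f (α - 1))⁻¹

/-- **[ExpEst] Def. 1.4**: "`J_{01}(α) := max{|α − 1|·|α|^{-1}, |α|·|α − 1|^{-1}}`".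
[cite: MochizukiEtAl2022, Def 1.4 p. 186] -/
def J01 (α : K) : ℝ := max (f (α - 1) * (f α)⁻¹) (f α * (f (α - 1))⁻¹)

/-- The product `J_{0∞}(α)·J_{1∞}(α)·J_{01}(α)` that Lemma 1.6 compares with `J(α)`.
[cite: MochizukiEtAl2022, Lemma 1.6 p. 187] -/
def jProd (α : K) : ℝ := J0inf f α * J1inf f α * J01 f α

/-- `J(α) ≥ 0`. [cite: MochizukiEtAl2022, Def 1.4 p. 186] -/
theorem J_nonneg (α : K) : 0 ≤ J f α := by
  unfold J; exact div_nonneg (pow_nonneg (f.nonneg _) _) (mul_nonneg (sq_nonneg _) (sq_nonneg _))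

/-! ## 5. Lemma 1.5 (Comparison between `J(α)` and `|α|²`), p. 186 -/

/-- **[ExpEst] Lemma 1.5**: "suppose that `|α| ≥ 2`. Then we have `|α|² ≤ 2^8·J(α)`." Printed proof:
`|α² − α + 1| ≥ |α|² − |α − 1| ≥ |α|² − (|α| + 1)`, `|α − 1| ≤ |α| + 1`, and the polynomial inequality
`2^8·(x² − x − 1)³ ≥ x⁴·(x + 1)²` for `x ≥ 2` (here certified by expanding in `x − 2` with nonnegative
coefficients). [cite: MochizukiEtAl2022, Lemma 1.5 p. 186] -/
theorem sq_le_two_pow_eight_mul_J (α : K) (h : 2 ≤ f α) : f α ^ 2 ≤ 2 ^ 8 * J f α := by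
  set x := f α with hx
  set y := f (α - 1) with hy
  set z := f (α ^ 2 - α + 1) with hz
  have hx0 : 0 < x := by linarith
  have hy1 : y ≤ x + 1 := by
    have h' := f.add_le α (-1)
    rw [← sub_eq_add_neg, f.map_neg, f.map_one] at h'
    exact h'
  have hy0 : 0 < y := by
    have := f.le_sub α 1
    rw [f.map_one] at this
    linarith
  have hz1 : x ^ 2 - y ≤ z := by
    have := f.le_sub (α ^ 2) (α - 1)
    rw [map_pow, show α ^ 2 - (α - 1) = α ^ 2 - α + 1 by ring] at this
    exact this
  have hq0 : 1 ≤ x ^ 2 - x - 1 := by nlinarith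
  have hz2 : x ^ 2 - x - 1 ≤ z := by linarith
  have hzpos : 0 < z := by linarith
  have hpoly : x ^ 4 * (x + 1) ^ 2 ≤ 256 * (x ^ 2 - x - 1) ^ 3 := by
    have ht : 0 ≤ x - 2 := by linarith
    have e : 256 * (x ^ 2 - x - 1) ^ 3 - x ^ 4 * (x + 1) ^ 2 =
        112 + 1920 * (x - 2) + 7256 * (x - 2) ^ 2 + 11272 * (x - 2) ^ 3 + 7599 * (x - 2) ^ 4 +
          2290 * (x - 2) ^ 5 + 255 * (x - 2) ^ 6 := by ring
    nlinarith [pow_nonneg ht 2, pow_nonneg ht 3, pow_nonneg ht 4, pow_nonneg ht 5, pow_nonneg ht 6]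
  have hy2 : y ^ 2 ≤ (x + 1) ^ 2 := pow_le_pow_left₀ hy0.le hy1 2
  have hz3 : (x ^ 2 - x - 1) ^ 3 ≤ z ^ 3 := pow_le_pow_left₀ (by linarith) hz2 3
  unfold J
  rw [← hx, ← hy, ← hz, ← mul_div_assoc, le_div_iff₀ (by positivity)]
  have hx4 : 0 ≤ x ^ 4 := by positivity
  nlinarith [mul_le_mul_of_nonneg_left hy2 hx4]

/-! ## 6. Lemma 1.6 (Comparison between `J(α)` and `J_{0∞}(α)·J_{1∞}(α)·J_{01}(α)`), p. 187–189 -/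

/-- `𝔖₃`-invariance of `J` under `α ↦ 1 − α` ("the manifest invariance of `J(α)` with respect to the
transformations `α ↦ 1 − α`, `α ↦ α^{-1}`", proof of Lemma 1.6, p. 188). [cite: MochizukiEtAl2022, Lemma 1.6 proof p. 188] -/
theorem J_one_sub (α : K) : J f (1 - α) = J f α := by
  unfold J
  have h1 : (1 - α) ^ 2 - (1 - α) + 1 = α ^ 2 - α + 1 := by ring
  have h2 : f (1 - α - 1) = f α := by rw [show (1 : K) - α - 1 = -α by ring, f.map_neg]
  have h3 : f (1 - α) = f (α - 1) := f.map_sub 1 α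
  rw [h1, h2, h3, mul_comm]

/-- `𝔖₃`-invariance of `J` under `α ↦ α^{-1}` (proof of Lemma 1.6, p. 188). [cite: MochizukiEtAl2022, Lemma 1.6 proof p. 188] -/
theorem J_inv (α : K) (hα : α ≠ 0) : J f α⁻¹ = J f α := by
  unfold J
  have hfα : f α ≠ 0 := f.ne_zero hα
  have h1 : α⁻¹ ^ 2 - α⁻¹ + 1 = (α ^ 2 - α + 1) / α ^ 2 := by field_simp; ring
  have h2 : α⁻¹ - 1 = -(α - 1) / α := by field_simp; ring
  rw [h1, h2, map_div₀, map_div₀, f.map_neg, map_pow, map_inv₀]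
  field_simp

/-- `𝔖₃`-invariance of `J_{0∞}J_{1∞}J_{01}` under `α ↦ 1 − α` ("cf. the fact discussed in the proof of Lemma 1.3
(i); Definition 1.4", proof of Lemma 1.6, p. 188). [cite: MochizukiEtAl2022, Lemma 1.6 proof p. 188] -/
theorem jProd_one_sub (α : K) : jProd f (1 - α) = jProd f α := by
  unfold jProd J0inf J1inf J01
  have h2 : f (1 - α - 1) = f α := by rw [show (1 : K) - α - 1 = -α by ring, f.map_neg]
  have h3 : f (1 - α) = f (α - 1) := f.map_sub 1 α
  rw [h2, h3, max_comm (f α * (f (α - 1))⁻¹)]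
  ring

/-- `𝔖₃`-invariance of `J_{0∞}J_{1∞}J_{01}` under `α ↦ α^{-1}` (proof of Lemma 1.6, p. 188).
[cite: MochizukiEtAl2022, Lemma 1.6 proof p. 188] -/
theorem jProd_inv (α : K) (hα : α ≠ 0) : jProd f α⁻¹ = jProd f α := by
  by_cases h1 : α = 1
  · rw [h1, inv_one]
  have hx : 0 < f α := f.pos hα
  have hy : 0 < f (α - 1) := f.pos (sub_ne_zero.mpr h1)
  unfold jProd J0inf J1inf J01
  have e1 : f α⁻¹ = (f α)⁻¹ := map_inv₀ f α
  have e2 : f (α⁻¹ - 1) = f (α - 1) / f α := by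
    rw [show α⁻¹ - 1 = -(α - 1) / α by field_simp; ring, map_div₀, f.map_neg]
  rw [e1, e2, inv_inv]
  set x := f α
  set y := f (α - 1)
  have e3 : max (y / x) (y / x)⁻¹ = max (y * x⁻¹) (x * y⁻¹) := by
    rw [inv_div, div_eq_mul_inv, div_eq_mul_inv]
  have e4 : max (y / x * x) (x⁻¹ * (y / x)⁻¹) = max y y⁻¹ := by
    rw [div_mul_cancel₀ y hx.ne', inv_div]
    congr 1
    field_simp
  rw [e3, e4, max_comm x⁻¹ x]
  ring

/-- **[ExpEst] Lemma 1.6 (ii) (the covering `F \ {0,1} = ⋃_{δ ∈ B} 𝔻_δ = ⋃_{σ ∈ 𝔖₃} σ·𝔻`)**, in the concrete form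
used in the proof of (iii)/(iv): for `α ∉ {0, 1}` one of the six `𝔖₃`-translates `β ∈ {α, 1−α, α^{-1},
(1−α)^{-1}, 1−α^{-1}, (1−α^{-1})^{-1}}` lies in `𝔻 = {f ∣ |f| ≥ |f − 1| ≥ 1}`, and `J`, `J_{0∞}J_{1∞}J_{01}` take the
same values at `β` and `α`. [cite: MochizukiEtAl2022, Lemma 1.6 (ii) p. 187] -/
theorem exists_moebius_mem_D (α : K) (h0 : α ≠ 0) (h1 : α ≠ 1) :
    ∃ β : K, β ≠ 0 ∧ β ≠ 1 ∧ (1 ≤ f (β - 1) ∧ f (β - 1) ≤ f β) ∧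
      J f β = J f α ∧ jProd f β = jProd f α := by
  have hα1 : α - 1 ≠ 0 := sub_ne_zero.mpr h1
  have h1α : (1 : K) - α ≠ 0 := sub_ne_zero.mpr (Ne.symm h1)
  have hαi : α⁻¹ ≠ 0 := inv_ne_zero h0
  have hαi1 : α⁻¹ ≠ 1 := fun h => h1 (inv_eq_one.mp h)
  have h1αi : (1 : K) - α⁻¹ ≠ 0 := sub_ne_zero.mpr (Ne.symm hαi1)
  set x := f α with hx
  set y := f (α - 1) with hy
  have hx0 : 0 < x := f.pos h0
  have hy0 : 0 < y := f.pos hα1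
  -- values of `f` on the six translates
  have v2a : f (1 - α) = y := f.map_sub 1 α
  have v2b : f (1 - α - 1) = x := by rw [show (1 : K) - α - 1 = -α by ring, f.map_neg]
  have v3a : f α⁻¹ = x⁻¹ := map_inv₀ f α
  have v3b : f (α⁻¹ - 1) = y / x := by
    rw [show α⁻¹ - 1 = -(α - 1) / α by field_simp; ring, map_div₀, f.map_neg]
  have v4a : f (1 - α)⁻¹ = y⁻¹ := by rw [map_inv₀, v2a]
  have v4b : f ((1 - α)⁻¹ - 1) = x / y := by
    rw [show (1 - α)⁻¹ - 1 = α / (1 - α) by field_simp; ring, map_div₀, v2a]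
  have v5a : f (1 - α⁻¹) = y / x := by
    rw [show (1 : K) - α⁻¹ = (α - 1) / α by field_simp, map_div₀]
  have v5b : f (1 - α⁻¹ - 1) = x⁻¹ := by
    rw [show (1 : K) - α⁻¹ - 1 = -α⁻¹ by ring, f.map_neg, map_inv₀]
  have v6a : f (1 - α⁻¹)⁻¹ = x / y := by rw [map_inv₀, v5a, inv_div]
  have v6b : f ((1 - α⁻¹)⁻¹ - 1) = y⁻¹ := by
    rw [show (1 - α⁻¹)⁻¹ - 1 = (α - 1)⁻¹ by field_simp; ring, map_inv₀]
  -- invariance of `J`, `jProd` on the six translates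
  have i2 : J f (1 - α) = J f α ∧ jProd f (1 - α) = jProd f α := ⟨J_one_sub f α, jProd_one_sub f α⟩
  have i3 : J f α⁻¹ = J f α ∧ jProd f α⁻¹ = jProd f α := ⟨J_inv f α h0, jProd_inv f α h0⟩
  have i4 : J f (1 - α)⁻¹ = J f α ∧ jProd f (1 - α)⁻¹ = jProd f α :=
    ⟨by rw [J_inv f _ h1α, J_one_sub], by rw [jProd_inv f _ h1α, jProd_one_sub]⟩
  have i5 : J f (1 - α⁻¹) = J f α ∧ jProd f (1 - α⁻¹) = jProd f α :=
    ⟨by rw [J_one_sub, J_inv f α h0], by rw [jProd_one_sub, jProd_inv f α h0]⟩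
  have i6 : J f (1 - α⁻¹)⁻¹ = J f α ∧ jProd f (1 - α⁻¹)⁻¹ = jProd f α :=
    ⟨by rw [J_inv f _ h1αi, J_one_sub, J_inv f α h0],
      by rw [jProd_inv f _ h1αi, jProd_one_sub, jProd_inv f α h0]⟩
  -- the six cases
  rcases le_or_gt 1 x with hx1 | hx1
  · rcases le_or_gt 1 y with hy1 | hy1
    · rcases le_total y x with hyx | hxy
      · exact ⟨α, h0, h1, ⟨hy1, hyx⟩, rfl, rfl⟩
      · refine ⟨1 - α, h1α, fun h => h0 (by simpa using h), ?_, i2.1, i2.2⟩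
        rw [v2a, v2b]; exact ⟨hx1, hxy⟩
    · refine ⟨(1 - α⁻¹)⁻¹, inv_ne_zero h1αi, fun h => ?_, ?_, i6.1, i6.2⟩
      · rw [inv_eq_one, sub_eq_self] at h; exact hαi h
      · rw [v6a, v6b]
        refine ⟨one_le_inv_iff₀.mpr ⟨hy0, hy1.le⟩, ?_⟩
        rw [div_eq_mul_inv]
        exact le_mul_of_one_le_left (inv_nonneg.mpr hy0.le) hx1
  · rcases le_or_gt 1 y with hy1 | hy1
    · refine ⟨1 - α⁻¹, h1αi, fun h => ?_, ?_, i5.1, i5.2⟩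
      · rw [sub_eq_self] at h; exact hαi h
      · rw [v5a, v5b]
        refine ⟨one_le_inv_iff₀.mpr ⟨hx0, hx1.le⟩, ?_⟩
        rw [div_eq_mul_inv]
        exact le_mul_of_one_le_left (inv_nonneg.mpr hx0.le) hy1
    · rcases le_total x y with hxy | hyx
      · refine ⟨α⁻¹, hαi, hαi1, ?_, i3.1, i3.2⟩
        rw [v3a, v3b]
        refine ⟨(one_le_div hx0).mpr hxy, ?_⟩
        rw [div_eq_mul_inv]
        exact mul_le_of_le_one_left (inv_nonneg.mpr hx0.le) hy1.le
      · refine ⟨(1 - α)⁻¹, inv_ne_zero h1α, fun h => ?_, ?_, i4.1, i4.2⟩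
        · rw [inv_eq_one, sub_eq_self] at h; exact h0 h
        · rw [v4a, v4b]
          refine ⟨(one_le_div hy0).mpr hyx, ?_⟩
          rw [div_eq_mul_inv]
          exact mul_le_of_le_one_left (inv_nonneg.mpr hy0.le) hx1.le

/-- On `𝔻 = {|α| ≥ |α − 1| ≥ 1}`: `J_{0∞}(α)·J_{1∞}(α)·J_{01}(α) = |α|²` (proof of Lemma 1.6, p. 188: "`J_{0∞}(α) = |α| ≥
1`, `J_{1∞}(α) = |α − 1| ≥ 1`, `J_{01}(α) = |α|·|α − 1|^{-1} ≥ 1`"). [cite: MochizukiEtAl2022, Lemma 1.6 proof p. 188] -/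
theorem jProd_eq_sq_of_mem_D {β : K} (h1 : 1 ≤ f (β - 1)) (h2 : f (β - 1) ≤ f β) :
    jProd f β = f β ^ 2 := by
  unfold jProd J0inf J1inf J01
  set x := f β
  set y := f (β - 1)
  have hy : 0 < y := by linarith
  have hx1 : 1 ≤ x := h1.trans h2
  have hx : 0 < x := by linarith
  have hmax : y * x⁻¹ ≤ x * y⁻¹ := by
    rw [← div_eq_mul_inv, ← div_eq_mul_inv, div_le_div_iff₀ hx hy]; nlinarith
  rw [max_eq_left ((inv_le_one_of_one_le₀ hx1).trans hx1),
    max_eq_left ((inv_le_one_of_one_le₀ h1).trans h1), max_eq_right hmax]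
  field_simp

/-- Lemma 1.6 (iii) on `𝔻` (proof p. 188–189: "`J_{0∞}J_{1∞}J_{01} ≤ 2²·max{2⁶·J, 1}` follows immediately from Lemma 1.5";
"`J(α) ≤ 2³·|α|^{-2}|α−1|^{-2}·max{|α|³|α−1|³, 1} = 2³·|α|·|α−1| ≤ 2³·|α|²`"). [cite: MochizukiEtAl2022, Lemma 1.6 (iii) proof p. 188–189] -/
private theorem core_iii {β : K} (h1 : 1 ≤ f (β - 1)) (h2 : f (β - 1) ≤ f β) {ε : ℝ} (hε : 0 ≤ ε) :
    jProd f β / 2 ^ 2 ≤ max ((2 : ℝ) ^ (6 + ε) * J f β) 1 ∧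
      max ((2 : ℝ) ^ (6 + ε) * J f β) 1 ≤ (2 : ℝ) ^ (9 + ε) * jProd f β := by
  rw [jProd_eq_sq_of_mem_D f h1 h2]
  set x := f β with hx
  set y := f (β - 1) with hy
  have hy0 : 0 < y := by linarith
  have hx1 : 1 ≤ x := h1.trans h2
  have hx0 : 0 < x := by linarith
  have hJ := J_nonneg f β
  have h26 : (2 : ℝ) ^ (6 : ℝ) ≤ (2 : ℝ) ^ (6 + ε) :=
    Real.rpow_le_rpow_of_exponent_le (by norm_num) (by linarith)
  have h64 : (2 : ℝ) ^ (6 : ℝ) = 64 := by norm_num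
  have h29 : (2 : ℝ) ^ (9 + ε) = 8 * (2 : ℝ) ^ (6 + ε) := by
    rw [show (9 : ℝ) + ε = 3 + (6 + ε) by ring, Real.rpow_add (by norm_num : (0 : ℝ) < 2)]
    norm_num
  have h2pos : (0 : ℝ) < (2 : ℝ) ^ (6 + ε) := by positivity
  constructor
  · -- first inequality
    rcases le_or_gt 2 x with hx2 | hx2
    · have h15 := sq_le_two_pow_eight_mul_J f β hx2
      rw [← hx] at h15
      calc x ^ 2 / 2 ^ 2 ≤ 2 ^ (6 : ℝ) * J f β := by rw [h64]; linarith
        _ ≤ (2 : ℝ) ^ (6 + ε) * J f β := mul_le_mul_of_nonneg_right h26 hJ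
        _ ≤ _ := le_max_left _ _
    · have : x ^ 2 / 2 ^ 2 < 1 := by
        rw [div_lt_one (by norm_num)]; nlinarith
      exact this.le.trans (le_max_right _ _)
  · -- second inequality
    refine max_le ?_ ?_
    · -- `2^{6+ε}·J ≤ 2^{9+ε}·x²`, i.e. `J ≤ 8x²`
      have hz : f (β ^ 2 - β + 1) ≤ 2 * (x * y) := by
        have h' := f.add_le (β * (β - 1)) 1
        rw [show β * (β - 1) + 1 = β ^ 2 - β + 1 by ring, map_mul, f.map_one] at h'
        have hxy : 1 ≤ x * y := one_le_mul_of_one_le_of_one_le hx1 h1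
        linarith
      have hJle : J f β ≤ 8 * x ^ 2 := by
        unfold J
        rw [← hx, ← hy, div_le_iff₀ (by positivity)]
        have hz3 : f (β ^ 2 - β + 1) ^ 3 ≤ (2 * (x * y)) ^ 3 := pow_le_pow_left₀ (f.nonneg _) hz 3
        have hyx : x ^ 3 * y ^ 3 ≤ x ^ 4 * y ^ 2 := by
          rw [show x ^ 3 * y ^ 3 = x ^ 3 * y ^ 2 * y by ring, show x ^ 4 * y ^ 2 = x ^ 3 * y ^ 2 * x by ring]
          exact mul_le_mul_of_nonneg_left h2 (by positivity)
        nlinarith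
      rw [h29]
      nlinarith
    · have : (1 : ℝ) ≤ (2 : ℝ) ^ (9 + ε) := Real.one_le_rpow (by norm_num) (by linarith)
      nlinarith

/-- Lemma 1.6 (iv) on `𝔻` (proof p. 189: nonarchimedean ⟹ `𝔻 = {|f| = |f − 1|}`; `|α| = |α−1| = 1` gives `J ≤ 1 = |α|²`,
`|α| = |α−1| > 1` gives `J = |α|⁶·|α|^{-4} = |α|²`). [cite: MochizukiEtAl2022, Lemma 1.6 (iv) proof p. 189] -/
private theorem core_iv (hf : IsNonarchimedean f) {β : K} (h1 : 1 ≤ f (β - 1)) (h2 : f (β - 1) ≤ f β) :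
    max (J f β) 1 = jProd f β := by
  rw [jProd_eq_sq_of_mem_D f h1 h2]
  set x := f β with hx
  set y := f (β - 1) with hy
  -- nonarchimedean: `x ≤ max{y, 1} = y`, hence `x = y`
  have hxy : x = y := by
    refine le_antisymm ?_ h2
    have h' := hf (β - 1) 1
    rw [sub_add_cancel, f.map_one] at h'
    exact h'.trans (max_le le_rfl h1)
  have hz_le : f (β ^ 2 - β + 1) ≤ max (x * y) 1 := by
    have h' := hf (β * (β - 1)) 1
    rwa [show β * (β - 1) + 1 = β ^ 2 - β + 1 by ring, map_mul, f.map_one] at h'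
  have hz_ge : x * y ≤ max (f (β ^ 2 - β + 1)) 1 := by
    have h' := hf (β ^ 2 - β + 1) (-1)
    rwa [show β ^ 2 - β + 1 + -1 = β * (β - 1) by ring, map_mul, f.map_neg, f.map_one] at h'
  rcases h1.eq_or_lt with hy1 | hy1
  · -- `x = y = 1`
    have hx1 : x = 1 := by rw [hxy, ← hy1]
    have hJ : J f β ≤ 1 := by
      unfold J
      rw [← hx, ← hy, hx1, ← hy1]
      have : f (β ^ 2 - β + 1) ≤ 1 := by rw [hx1, ← hy1] at hz_le; simpa using hz_le
      have h3 : f (β ^ 2 - β + 1) ^ 3 ≤ 1 := pow_le_one₀ (f.nonneg _) this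
      simpa using h3
    rw [max_eq_right hJ, hx1]; norm_num
  · -- `x = y > 1`
    have hxy1 : 1 < x * y := by rw [hxy]; nlinarith
    have hz : f (β ^ 2 - β + 1) = x * y := by
      refine le_antisymm (hz_le.trans (max_le le_rfl hxy1.le)) ?_
      rcases le_or_gt 1 (f (β ^ 2 - β + 1)) with h | h
      · rwa [max_eq_left h] at hz_ge
      · rw [max_eq_right h.le] at hz_ge; linarith
    have hJ : J f β = x ^ 2 := by
      unfold J; rw [← hx, ← hy, hz, ← hxy]
      have : x ≠ 0 := by linarith
      field_simp
    rw [hJ, max_eq_left (by nlinarith)]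

/-- **[ExpEst] Lemma 1.6 (iii)**: "For any `ε ∈ ℝ_{>0}`, we have `2^{-2}·J_{0∞}(α)·J_{1∞}(α)·J_{01}(α) ≤
max{2^{6+ε}·J(α), 1} ≤ 2^{9+ε}·J_{0∞}(α)·J_{1∞}(α)·J_{01}(α)`" (`α ∈ F \ {0,1}`; typed for `ε ≥ 0`, as the proof
"we may assume without loss of generality, that `ε = 0`" shows). Proof as printed: reduce to `α ∈ 𝔻` by the
`𝔖₃`-symmetry (`exists_moebius_mem_D`), then Lemma 1.5. [cite: MochizukiEtAl2022, Lemma 1.6 (iii) p. 187] -/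
theorem jProd_le_max_and_max_le_jProd (α : K) (h0 : α ≠ 0) (h1 : α ≠ 1) {ε : ℝ} (hε : 0 ≤ ε) :
    jProd f α / 2 ^ 2 ≤ max ((2 : ℝ) ^ (6 + ε) * J f α) 1 ∧
      max ((2 : ℝ) ^ (6 + ε) * J f α) 1 ≤ (2 : ℝ) ^ (9 + ε) * jProd f α := by
  obtain ⟨β, -, -, hD, hJ, hP⟩ := exists_moebius_mem_D f α h0 h1
  rw [← hJ, ← hP]
  exact core_iii f hD.1 hD.2 hε

/-- **[ExpEst] Lemma 1.6 (iv)**: "Suppose that `|·|` is nonarchimedean, i.e., that for any `x ∈ F`, it holds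
that `|x + 1| ≤ max{|x|, 1}`. … Then we have `max{J(α), 1} = J_{0∞}(α)·J_{1∞}(α)·J_{01}(α)`" (`α ∈ F \ {0,1}`).
[cite: MochizukiEtAl2022, Lemma 1.6 (iv) p. 187] -/
theorem max_J_one_eq_jProd (hf : IsNonarchimedean f) (α : K) (h0 : α ≠ 0) (h1 : α ≠ 1) :
    max (J f α) 1 = jProd f α := by
  obtain ⟨β, -, -, hD, hJ, hP⟩ := exists_moebius_mem_D f α h0 h1
  rw [← hJ, ← hP]
  exact core_iv f hf hD.1 hD.2

end AbsValue

end ExpEst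

end Literature.IUT.LogVolume

end
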